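import Mathlib
import Literature.Analysis.OperatorTheory.ContractiveDeterminantalRepresentation
import Literature.Analysis.OperatorTheory.ContractiveDeterminantalRepresentationProofs
import Literature.Computability.AlgebraicComplexity.StandardFamilies
import Literature.Computability.AlgebraicComplexity.StandardFamiliesProofs
import Literature.Computability.AlgebraicComplexity.PermanentIrreducible
import Literature.Computability.AlgebraicComplexity.BurgisserBooleanParts
import Summits.ValiantsHypothesis.ValiantsHypothesis.Theorems.ContractivityPriceContractiveHardnessNonSurjective

/-!
# Stub `stub_surjectiveReduction` of crux `ContractivityPrice.ContractiveHardness`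
# (line `registered` = BC3 birth skeleton `Cruxes/ContractiveHardness/Lines/birth.lean`, reshape 2)

The argument of Grinshpan–Kaliuzhnyi-Verbovetskyi–Woerdeman 2013, Thm. 5.6 (arXiv:1208.2288,
p. 10–11), run for the stabilised permanent `Q_n = per_n(I + z/(4n))`: if a colligation
`U = [[A, B], [C, D]]` (unitary or not) realizes `z^m Q̄_n(1/z) / Q_n` with block structure `κ'`
(`IsRealizedBy κ' U (conjReverse m Q_n) Q_n`), where `m = blockOrder κ` for a SURJECTIVE
`κ : Fin R → [n]²` (so `m ≥ 𝟙` and `conjReverse m Q_n = z^{m−𝟙} · z^𝟙 Q̄_n(1/z)` is a genuine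
reflection), then `Q_n` DIVIDES the state-pencil determinant `s = det(I − D Z_{κ'})`,
`D = U₂₂`.  Indeed (Lemma 2.2, tree `IsRealizedBy.mul_gkvwDet_eq`) `conjReverse m Q_n · s = Q_n · r`;
`Q_n` is irreducible (`per_n` is — von zur Gathen — and `x_e ↦ δ_e + x_e/(4n)` is an automorphism),
hence prime in the UFD `ℂ[z]`; and `Q_n ∤ conjReverse m Q_n`: as `Q_n(0) = 1`, `Q_n` is coprime to
monomials, so it would divide `Q̃ = z^𝟙 Q̄_n(1/z)`; both are multi-affine and every variable occurs in
`Q_n`, so the quotient is a constant `c`, `Q̃ = c · Q_n`; comparing the coefficients of `z^𝟙`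
(`1` on the left by `coeff_conjReverse_self`, `c · 0` on the right since `deg Q_n = n < n²` for
`n ≥ 2`) is absurd.

So for surjective block structures the realization-hardness stub reduces to the purely algebraic
statement "`Q_n` divides no quasi-polynomial pencil determinant `det(I − D Z)` with `D` the corner
of a unitary" (registered stub `stub_defectOneMultiplesHard`, the open core of the line).

Contents: generic `degreeOf_aeval_le_weighted`; for `Q_n`: `degreeOf_stabPer_le_one`,
`totalDegree_stabPer_le`, `constantCoeff_stabPer`, `irreducible_stabPer`,
`not_dvd_conjReverse_ones_stabPer`; and the registered stub `stub_surjectiveReduction`.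
-/

noncomputable section

namespace Summit.ValiantsHypothesis.ValiantsHypothesis.Theorems

open MvPolynomial Matrix Literature.Analysis.OperatorTheory
open Literature.Computability.AlgebraicComplexity

set_option linter.dupNamespace false

/-! ## A generic degree bound for substitutions -/

section General

variable {σ τ : Type*} {R : Type*} [CommSemiring R]

/-- Degree in the variable `x` of a substitution `aeval v f`, weighted by bounds `w i` on the
`x`-degrees of the substituted values `v i`. [folklore] -/
theorem degreeOf_aeval_le_weighted [DecidableEq τ] (v : σ → MvPolynomial τ R) (x : τ) (w : σ → ℕ)
    (hw : ∀ i, (v i).degreeOf x ≤ w i) (f : MvPolynomial σ R) :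
    (aeval v f).degreeOf x ≤ f.support.sup fun s => ∑ i ∈ s.support, s i * w i := by
  classical
  conv_lhs => rw [f.as_sum, map_sum]
  refine (degreeOf_sum_le _ _ _).trans (Finset.sup_mono_fun fun s _ => ?_)
  rw [aeval_monomial, Finsupp.prod]
  refine (degreeOf_mul_le _ _ _).trans ?_
  rw [MvPolynomial.algebraMap_eq, degreeOf_C, zero_add]
  refine (degreeOf_prod_le _ _ _).trans (Finset.sum_le_sum fun i _ => ?_)
  exact (degreeOf_pow_le _ _ _).trans (Nat.mul_le_mul_left _ (hw i))

end General

/-! ## The stabilised permanent: degrees, constant term, irreducibility, reflection -/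

section StabPer

variable {n : ℕ}

/-- `Q_n` is multi-affine: every variable has degree `≤ 1` in `per_n(I + z/(4n))` (the substituted
values `δ_e + z_e/(4n)` have `z_x`-degree `[e = x]`, and `per_n` is multi-affine). [folklore] -/
theorem degreeOf_stabPer_le_one (x : Fin n × Fin n) :
    (MvPolynomial.aeval (fun e : Fin n × Fin n =>
          MvPolynomial.C (if e.1 = e.2 then (1 : ℂ) else 0) +
            MvPolynomial.C ((4 * (n : ℂ))⁻¹) * MvPolynomial.X e)
        (perPoly (Fin n) ℂ)).degreeOf x ≤ 1 := by
  classical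
  have hw : ∀ e : Fin n × Fin n,
      (MvPolynomial.C (if e.1 = e.2 then (1 : ℂ) else 0) +
          MvPolynomial.C ((4 * (n : ℂ))⁻¹) * MvPolynomial.X e : MvPolynomial (Fin n × Fin n) ℂ).degreeOf x ≤
        if e = x then 1 else 0 := by
    intro e
    refine (degreeOf_add_le _ _ _).trans (max_le ?_ ?_)
    · rw [degreeOf_C]; exact Nat.zero_le _
    · refine (degreeOf_C_mul_le _ _ _).trans ?_
      rw [degreeOf_X]
      by_cases h : x = e
      · subst h; simp
      · rw [if_neg h]; exact Nat.zero_le _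
  refine (degreeOf_aeval_le_weighted _ x _ hw _).trans (Finset.sup_le fun s hs => ?_)
  calc ∑ i ∈ s.support, s i * (if i = x then 1 else 0)
      = ∑ i ∈ s.support, (if i = x then s i else 0) :=
        Finset.sum_congr rfl fun i _ => by split_ifs <;> simp
    _ ≤ s x := by rw [Finset.sum_ite_eq']; split_ifs <;> simp
    _ ≤ (perPoly (Fin n) ℂ).degreeOf x := monomial_le_degreeOf x hs
    _ = 1 := degreeOf_perPoly ℂ x

/-- Every exponent of `Q_n` is `≤ 𝟙` (the all-ones order). [folklore] -/
theorem le_ones_of_mem_support_stabPer {α : (Fin n × Fin n) →₀ ℕ}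
    (hα : α ∈ (MvPolynomial.aeval (fun e : Fin n × Fin n =>
          MvPolynomial.C (if e.1 = e.2 then (1 : ℂ) else 0) +
            MvPolynomial.C ((4 * (n : ℂ))⁻¹) * MvPolynomial.X e)
        (perPoly (Fin n) ℂ)).support) :
    α ≤ Finsupp.equivFunOnFinite.symm (fun _ : Fin n × Fin n => 1) := by
  intro x
  rw [Finsupp.coe_equivFunOnFinite_symm]
  exact (monomial_le_degreeOf x hα).trans (degreeOf_stabPer_le_one x)

/-- `deg Q_n ≤ n`: the substituted values are affine and `deg per_n = n`. [folklore] -/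
theorem totalDegree_stabPer_le :
    (MvPolynomial.aeval (fun e : Fin n × Fin n =>
          MvPolynomial.C (if e.1 = e.2 then (1 : ℂ) else 0) +
            MvPolynomial.C ((4 * (n : ℂ))⁻¹) * MvPolynomial.X e)
        (perPoly (Fin n) ℂ)).totalDegree ≤ n := by
  have h1 : ∀ e : Fin n × Fin n,
      (MvPolynomial.C (if e.1 = e.2 then (1 : ℂ) else 0) +
          MvPolynomial.C ((4 * (n : ℂ))⁻¹) * MvPolynomial.X e : MvPolynomial (Fin n × Fin n) ℂ).totalDegree ≤ 1 := by
    intro e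
    refine (totalDegree_add _ _).trans (max_le ?_ ?_)
    · rw [totalDegree_C]; exact Nat.zero_le _
    · refine (totalDegree_mul _ _).trans ?_
      rw [totalDegree_C, totalDegree_X, zero_add]
  refine (Literature.Computability.AlgebraicComplexity.totalDegree_aeval_le_of_le_one _ h1 _).trans ?_
  rw [totalDegree_perPoly_holds, Fintype.card_fin]

/-- `Q_n(0) = per(I_n) = 1`: the constant coefficient of `Q_n` is `1`. [folklore] -/
theorem constantCoeff_stabPer :
    MvPolynomial.constantCoeff (MvPolynomial.aeval (fun e : Fin n × Fin n =>
          MvPolynomial.C (if e.1 = e.2 then (1 : ℂ) else 0) +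
            MvPolynomial.C ((4 * (n : ℂ))⁻¹) * MvPolynomial.X e)
        (perPoly (Fin n) ℂ)) = 1 := by
  rw [← DFunLike.congr_fun MvPolynomial.eval_zero]
  have hval : MvPolynomial.eval (0 : Fin n × Fin n → ℂ) (MvPolynomial.aeval (fun e : Fin n × Fin n =>
          MvPolynomial.C (if e.1 = e.2 then (1 : ℂ) else 0) +
            MvPolynomial.C ((4 * (n : ℂ))⁻¹) * MvPolynomial.X e)
        (perPoly (Fin n) ℂ)) =
      (1 + Matrix.of fun i j : Fin n => (4 * (n : ℂ))⁻¹ * (0 : Fin n × Fin n → ℂ) (i, j)).permanent := by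
    simp only [Literature.Computability.AlgebraicComplexity.perPoly, Matrix.permanent, map_sum,
      map_prod, Matrix.mvPolynomialX_apply, MvPolynomial.aeval_X, map_add, map_mul,
      MvPolynomial.eval_C, MvPolynomial.eval_X,
      Matrix.add_apply, Matrix.one_apply, Matrix.of_apply]
  rw [hval]
  have h0 : (Matrix.of fun i j : Fin n => (4 * (n : ℂ))⁻¹ * (0 : Fin n × Fin n → ℂ) (i, j)) = 0 := by
    ext i j; simp
  rw [h0, add_zero, Matrix.permanent_one]

/-- **`Q_n` is irreducible** (`n ≥ 1`): `per_n` is irreducible (von zur Gathen 1987, tree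
`perPoly_irreducible`) and `x_e ↦ δ_e + x_e/(4n)` extends to a `ℂ`-algebra automorphism of `ℂ[z]`
(inverse `x_e ↦ 4n (x_e − δ_e)`). [folklore] -/
theorem irreducible_stabPer (hn : 1 ≤ n) :
    Irreducible (MvPolynomial.aeval (fun e : Fin n × Fin n =>
          MvPolynomial.C (if e.1 = e.2 then (1 : ℂ) else 0) +
            MvPolynomial.C ((4 * (n : ℂ))⁻¹) * MvPolynomial.X e)
        (perPoly (Fin n) ℂ)) := by
  have hc : (4 * (n : ℂ)) ≠ 0 :=
    mul_ne_zero (by norm_num) (Nat.cast_ne_zero.mpr (by omega))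
  set c : ℂ := 4 * (n : ℂ) with hc4
  set φ : Fin n × Fin n → MvPolynomial (Fin n × Fin n) ℂ := fun e =>
    MvPolynomial.C (if e.1 = e.2 then (1 : ℂ) else 0) + MvPolynomial.C c⁻¹ * MvPolynomial.X e
    with hφ
  set ψ : Fin n × Fin n → MvPolynomial (Fin n × Fin n) ℂ := fun e =>
    MvPolynomial.C c * (MvPolynomial.X e - MvPolynomial.C (if e.1 = e.2 then (1 : ℂ) else 0))
    with hψ
  have hψφ : (MvPolynomial.aeval ψ).comp (MvPolynomial.aeval φ) =
      AlgHom.id ℂ (MvPolynomial (Fin n × Fin n) ℂ) := by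
    rw [MvPolynomial.comp_aeval]
    have hid : (fun i => MvPolynomial.aeval ψ (φ i)) = MvPolynomial.X := by
      funext i
      have h1 : MvPolynomial.aeval ψ (φ i) =
          MvPolynomial.C (if i.1 = i.2 then (1 : ℂ) else 0) +
            MvPolynomial.C c⁻¹ * (MvPolynomial.C c *
              (MvPolynomial.X i - MvPolynomial.C (if i.1 = i.2 then (1 : ℂ) else 0))) := by
        simp only [hφ, hψ, map_add, map_mul, MvPolynomial.aeval_C, MvPolynomial.aeval_X,
          MvPolynomial.algebraMap_eq]
      rw [h1, ← mul_assoc, ← map_mul, inv_mul_cancel₀ hc, map_one, one_mul]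
      ring
    rw [hid, MvPolynomial.aeval_X_left]
  have hφψ : (MvPolynomial.aeval φ).comp (MvPolynomial.aeval ψ) =
      AlgHom.id ℂ (MvPolynomial (Fin n × Fin n) ℂ) := by
    rw [MvPolynomial.comp_aeval]
    have hid : (fun i => MvPolynomial.aeval φ (ψ i)) = MvPolynomial.X := by
      funext i
      have h1 : MvPolynomial.aeval φ (ψ i) =
          MvPolynomial.C c * (MvPolynomial.C (if i.1 = i.2 then (1 : ℂ) else 0) +
            MvPolynomial.C c⁻¹ * MvPolynomial.X i - MvPolynomial.C (if i.1 = i.2 then (1 : ℂ) else 0)) := by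
        simp only [hφ, hψ, map_sub, map_mul, MvPolynomial.aeval_C, MvPolynomial.aeval_X,
          MvPolynomial.algebraMap_eq]
      rw [h1, add_sub_cancel_left, ← mul_assoc, ← map_mul, mul_inv_cancel₀ hc, map_one, one_mul]
    rw [hid, MvPolynomial.aeval_X_left]
  set E : MvPolynomial (Fin n × Fin n) ℂ ≃ₐ[ℂ] MvPolynomial (Fin n × Fin n) ℂ :=
    AlgEquiv.ofAlgHom (MvPolynomial.aeval φ) (MvPolynomial.aeval ψ) hφψ hψφ with hE
  have hEper : E (perPoly (Fin n) ℂ) = MvPolynomial.aeval φ (perPoly (Fin n) ℂ) := rfl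
  haveI : Nonempty (Fin n) := ⟨⟨0, by omega⟩⟩
  rw [← hEper]
  exact (MulEquiv.irreducible_iff E.toMulEquiv).mpr (perPoly_irreducible (n := Fin n) (R := ℂ))

/-- A surjective block structure has block order `≥ 𝟙`. [folklore] -/
theorem ones_le_blockOrder_of_surjective {R : ℕ} {κ : Fin R → Fin n × Fin n}
    (hκ : Function.Surjective κ) :
    Finsupp.equivFunOnFinite.symm (fun _ : Fin n × Fin n => 1) ≤ blockOrder κ := by
  classical
  intro e
  rw [Finsupp.coe_equivFunOnFinite_symm]
  obtain ⟨i, hi⟩ := hκ e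
  rw [blockOrder, Finsupp.coe_finsetSum, Finset.sum_apply]
  calc 1 = (Finsupp.single (κ i) 1 : (Fin n × Fin n) →₀ ℕ) e := by rw [hi, Finsupp.single_eq_same]
    _ ≤ ∑ j, (Finsupp.single (κ j) 1 : (Fin n × Fin n) →₀ ℕ) e :=
        Finset.single_le_sum (f := fun j => (Finsupp.single (κ j) 1 : (Fin n × Fin n) →₀ ℕ) e)
          (fun j _ => Nat.zero_le _) (Finset.mem_univ i)

/-- **`Q_n` does not divide its reflection `z^𝟙 Q̄_n(1/z)`** (`n ≥ 2`): both are multi-affine and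
every variable occurs in `Q_n`, so a quotient would be constant, `Q̃ = c · Q_n`; but the
`z^𝟙`-coefficient of `Q̃` is `conj Q_n(0) = 1` while that of `Q_n` is `0` (`deg Q_n = n < n²`).
[folklore] -/
theorem not_dvd_conjReverse_ones_stabPer (hn : 2 ≤ n) :
    ¬ (MvPolynomial.aeval (fun e : Fin n × Fin n =>
          MvPolynomial.C (if e.1 = e.2 then (1 : ℂ) else 0) +
            MvPolynomial.C ((4 * (n : ℂ))⁻¹) * MvPolynomial.X e)
        (perPoly (Fin n) ℂ)) ∣
      conjReverse (Finsupp.equivFunOnFinite.symm (fun _ : Fin n × Fin n => 1))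
        (MvPolynomial.aeval (fun e : Fin n × Fin n =>
          MvPolynomial.C (if e.1 = e.2 then (1 : ℂ) else 0) +
            MvPolynomial.C ((4 * (n : ℂ))⁻¹) * MvPolynomial.X e)
        (perPoly (Fin n) ℂ)) := by
  classical
  set Q := MvPolynomial.aeval (fun e : Fin n × Fin n =>
          MvPolynomial.C (if e.1 = e.2 then (1 : ℂ) else 0) +
            MvPolynomial.C ((4 * (n : ℂ))⁻¹) * MvPolynomial.X e)
        (perPoly (Fin n) ℂ) with hQ
  set ones : (Fin n × Fin n) →₀ ℕ := Finsupp.equivFunOnFinite.symm (fun _ : Fin n × Fin n => 1)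
    with hones
  have hones_apply : ∀ e, ones e = 1 := fun e => by
    rw [hones, Finsupp.coe_equivFunOnFinite_symm]
  have hsupp : ∀ α ∈ Q.support, α ≤ ones := fun α hα => le_ones_of_mem_support_stabPer hα
  rintro ⟨t, ht⟩
  -- the `z^𝟙`-coefficient of `Q̃` is `conj Q(0) = 1`
  have h1 : coeff ones (conjReverse ones Q) = 1 := by
    rw [coeff_conjReverse_self hsupp, ← constantCoeff_eq, constantCoeff_stabPer, map_one]
  have hQt0 : conjReverse ones Q ≠ 0 := fun h => by
    rw [h, coeff_zero] at h1; exact zero_ne_one h1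
  have hQ0 : Q ≠ 0 := fun h => by
    have h0 := constantCoeff_stabPer (n := n)
    rw [← hQ, h, map_zero] at h0
    exact zero_ne_one h0
  have ht0 : t ≠ 0 := fun h => by rw [h, mul_zero] at ht; exact hQt0 ht
  -- degree count: `t` is constant
  have hdeg : ∀ e, t.degreeOf e = 0 := by
    intro e
    have hle : (conjReverse ones Q).degreeOf e ≤ 1 := by
      rw [degreeOf_def]
      calc Multiset.count e (conjReverse ones Q).degrees
          ≤ Multiset.count e (Finsupp.toMultiset ones) :=
            Multiset.count_le_of_le e (degrees_conjReverse_le ones Q)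
        _ = 1 := by rw [Finsupp.count_toMultiset, hones_apply]
    have hge : 1 ≤ Q.degreeOf e := by
      have hmem := mem_vars_stabPer (n := n) e
      rw [← hQ] at hmem
      rw [degreeOf_def]
      exact Multiset.one_le_count_iff_mem.mpr (by rwa [MvPolynomial.vars_def, Multiset.mem_toFinset] at hmem)
    rw [ht, degreeOf_mul_eq hQ0 ht0] at hle
    omega
  have htC : t = MvPolynomial.C (t.coeff 0) := by
    apply totalDegree_eq_zero_iff_eq_C.mp
    have hdegs : t.degrees = 0 := by
      refine Multiset.ext.mpr fun e => ?_
      rw [Multiset.count_zero, ← degreeOf_def]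
      exact hdeg e
    have := totalDegree_le_degrees_card t
    rw [hdegs, Multiset.card_zero] at this
    exact Nat.le_zero.mp this
  -- compare the `z^𝟙`-coefficients: `1 = coeff ones Q * t₀ = 0`
  have hQones : coeff ones Q = 0 := by
    refine coeff_eq_zero_of_totalDegree_lt ?_
    calc Q.totalDegree ≤ n := totalDegree_stabPer_le
      _ < n * n := by nlinarith
      _ = ∑ i ∈ ones.support, ones i := by
          have hsup : ones.support = Finset.univ := by
            ext e; simp [Finsupp.mem_support_iff, hones_apply]
          rw [hsup, Finset.sum_congr rfl fun e _ => hones_apply e, Finset.sum_const, Finset.card_univ,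
            Fintype.card_prod, Fintype.card_fin, smul_eq_mul, mul_one]
  rw [ht, htC, mul_comm, coeff_C_mul, hQones, mul_zero] at h1
  exact zero_ne_one h1

end StabPer

/-! ## The registered stub -/

/-- **Registered stub `stub_surjectiveReduction`** (line `registered`/birth of crux
`ContractivityPrice.ContractiveHardness`, reshape 2) — the argument of [GKVW 2013, Thm. 5.6] for the
stabilised permanent: for `n ≥ 2` and a SURJECTIVE block structure `κ`, any colligation `U`
realizing `conjReverse (blockOrder κ) Q_n / Q_n` with block structure `κ'` has a state pencil whose
determinant `det(I − U₂₂ Z_{κ'})` is DIVISIBLE by `Q_n` (`Q_n` is prime and does not divide the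
numerator `z^{m−𝟙} · z^𝟙 Q̄_n(1/z)`). [cite: GrinshpanKaliuzhnyiverbovetsWoerdeman2012, Thm. 5.6] -/
theorem stub_surjectiveReduction :
    ∀ (n R : ℕ) (κ : Fin R → Fin n × Fin n), 2 ≤ n → Function.Surjective κ →
      ∀ (R' : ℕ) (κ' : Fin R' → Fin n × Fin n)
        (U : Matrix (Fin 1 ⊕ Fin R') (Fin 1 ⊕ Fin R') ℂ),
        IsRealizedBy κ' U
            (conjReverse (blockOrder κ)
              (MvPolynomial.aeval (fun e : Fin n × Fin n =>
                  MvPolynomial.C (if e.1 = e.2 then (1 : ℂ) else 0) +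
                    MvPolynomial.C ((4 * (n : ℂ))⁻¹) * MvPolynomial.X e)
                (Literature.Computability.AlgebraicComplexity.perPoly (Fin n) ℂ)))
            (MvPolynomial.aeval (fun e : Fin n × Fin n =>
                MvPolynomial.C (if e.1 = e.2 then (1 : ℂ) else 0) +
                  MvPolynomial.C ((4 * (n : ℂ))⁻¹) * MvPolynomial.X e)
              (Literature.Computability.AlgebraicComplexity.perPoly (Fin n) ℂ)) →
        (MvPolynomial.aeval (fun e : Fin n × Fin n =>
            MvPolynomial.C (if e.1 = e.2 then (1 : ℂ) else 0) +
              MvPolynomial.C ((4 * (n : ℂ))⁻¹) * MvPolynomial.X e)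
          (Literature.Computability.AlgebraicComplexity.perPoly (Fin n) ℂ)) ∣
          gkvwDet κ' U.toBlocks₂₂ := by
  intro n R κ hn hκ R' κ' U hreal
  classical
  set Q := MvPolynomial.aeval (fun e : Fin n × Fin n =>
          MvPolynomial.C (if e.1 = e.2 then (1 : ℂ) else 0) +
            MvPolynomial.C ((4 * (n : ℂ))⁻¹) * MvPolynomial.X e)
        (perPoly (Fin n) ℂ) with hQ
  set ones : (Fin n × Fin n) →₀ ℕ := Finsupp.equivFunOnFinite.symm (fun _ : Fin n × Fin n => 1)
    with hones
  have hsupp : ∀ α ∈ Q.support, α ≤ ones := fun α hα => le_ones_of_mem_support_stabPer hα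
  have hm : ones ≤ blockOrder κ := ones_le_blockOrder_of_surjective hκ
  -- Step 1 (Lemma 2.2): `num · s = Q · r`
  have h1 := hreal.mul_gkvwDet_eq
  have hdvd : Q ∣ conjReverse (blockOrder κ) Q * gkvwDet κ' U.toBlocks₂₂ := ⟨_, h1⟩
  -- `Q` is prime
  have hprime : Prime Q := (irreducible_stabPer (n := n) (by omega)).prime
  rcases hprime.dvd_or_dvd hdvd with hnum | hs
  · -- `Q ∣ z^{m − 𝟙} · Q̃` forces `Q ∣ Q̃`, impossible
    exfalso
    rw [conjReverse_eq_monomial_mul hm hsupp] at hnum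
    obtain ⟨m', p', -, hp'dvd, hpp'⟩ := dvd_monomial_mul_iff_exists.mp hnum
    have hm' : m' = 0 := by
      by_contra hne
      have := congrArg constantCoeff hpp'
      rw [map_mul, constantCoeff_monomial, if_neg hne, zero_mul, hQ, constantCoeff_stabPer] at this
      exact one_ne_zero this
    rw [hm', monomial_zero', C_1, one_mul] at hpp'
    rw [← hpp'] at hp'dvd
    exact not_dvd_conjReverse_ones_stabPer hn hp'dvd
  · exact hs

end Summit.ValiantsHypothesis.ValiantsHypothesis.Theorems

end
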